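import Mathlib
import HarnessLib
import Summits.HubbardSuperconductivity.HubbardSuperconductivity.Theorems.KLProgrammeKLRegimeFlowReadScaleZeroAssemblyPieces
import Summits.HubbardSuperconductivity.HubbardSuperconductivity.Theorems.KLProgrammeKLRegimeFlowReadScaleZeroAssemblyRows
import Summits.HubbardSuperconductivity.HubbardSuperconductivity.Theorems.KLProgrammeKLRegimeFlowReadScaleZeroSunsetSizes
import Summits.HubbardSuperconductivity.HubbardSuperconductivity.Theorems.KLProgrammeKLRegimeFlowReadScaleZeroChainReadJets

/-!
# Route `KLProgramme`, crux K3 — gen-8 ENGINE-FLOW child (stmt-HubbardSuperconductivity-20437 `KLRegimeEngineV17F2`), stub (C) at `n = 0`,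
# located item #22 «(C)-SCALE0-PT2», assembly kit (4/4): THE ASSEMBLY — (C)'s `n = 0` pair from the TAIL rows, the CERTIFIED SUNSET SUMS (rows `k ≤ 2`, #22a),
# the sunset's ON-CURVE rows `k = 3, 4` (#22b) and the chain's aliasing table, through the MIXED door

Seat hubbard-kl-k3c5-p1 (g14; owner of #22a).  Split of record (π4, `…FlowReadScaleZeroSunsetSplit`): `W₀ = W_a″ + W_b″`, `W_a″ := W₀ − S − Q_c − D_e`
(two-leg kernel = the order-`≥ 3` tail `T₃`'s, entry by entry), `W_b″ := S + Q_c + D_e` (off-diagonal sunset + Hartree chain + diagonal constant).  The MIXED door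
(k3c3-p1 p608958 `twoLegRead_frameZero_of_split_certD`) is fed as follows — every input a HYPOTHESIS in its supplier's currency, nothing asserted:
* `W_a″` rows `(a-on)/(a-off)` ⟸ the TAIL rows `hTon` / `hToff` for `T₃` (p1 g18 `twoLeg_wsum_tail3_frameZero_le_booked` /
  `twoLeg_offDiag_moment_pow_sum_tail3_frameZero_le_booked`: `tv = 2¹³e²⁷46³a²/10⁷⁴`, `tb k = (2/λ)ᵏ2¹³e²⁷46³a²/10³⁷`);
* `W_b″` value / structured value / jets `k = 1, 2` ⟸ the sunset's pinned COVARIANCE sums (`hSall` plain, `hS0` off-site indicator, `hSk` Euclidean moments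
  `k = 1, 2`; certified tables `bS₀, bS₁, bS₂ᴱ` of SCALE0-PT2-CERT-SPEC v2 §0 after the β/L/M layers) via `gridSymbol_norm_le_of_pinned`,
  `gridSymbol_structuredValue_of_offSite`, `gridSymbol_jet_le_of_euclid` and the structured chain rule at orders 1, 2;
* `W_b″` jets `k = 3, 4` ⟸ the sunset's ON-CURVE jets `hSjet` (#22b, k3c3-p1; ENGINE-1/2 numbers `S₃*, S₄*` in table units) + the chain's pure-aliasing table
  (p615543 `chain_readJets_frameZero_le_bell4`, majorants `a j·U²`) + `0` from the constant `c_e` (p619685, `|c_e| ≤ 4|U| + (2048 + 64ε)U²`).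
Output (**`twoLegRead_frameZero_of_sunsetData`**): `TwoLegReadJetBound L M cJ cJ′ β U μ (K₀) 0 ∧ TwoLegReadOscAt L M (4·tb₀ + 2(bS₀ + a₀)) β U μ (K₀) 0` with
`cJ = (2tv + 4, 2tb₁D₁ + bS₁D₁ + bell4 a D 1, 2tb₂D₁² + 2tb₁D₂ + bS₂D₁² + bS₁D₂ + bell4 a D 2, Bell₃(2tb,D) + sS₃ + bell4 a D 3, Bell₄(2tb,D) + sS₄ + bell4 a D 4, 0,…)`,
`cJ′ = (2tb₀ + bSA + a₀ + 2048 + 64ε, 0, …)` (`ε = β/4M`).  The registered `n = 0` pair then follows by k3c3-p1's five fits (`twoLegRead_frameZero_registered_of_split_certD`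
pattern / `TwoLegReadJetBound.mono_le`).

Proofs only; no definitions; nothing asserts any stub of 20437, K3 or superconductivity.
References: BGM 2006 §2.1–§2.4 [cite: BenfattoGiulianiMastropietro2006]; FST II [cite: FeldmanSalmhoferTrubowitz1998].
-/
noncomputable section

namespace Summit.HubbardSuperconductivity.HubbardSuperconductivity.Theorems.KLRegimeSplit

set_option linter.dupNamespace false -- summit = problem name (single-conjunct summit), D-0017

open Real Finset Complex Literature.MathematicalPhysics.QuantumLattice Literature.Probability.LatticeModels GrassmannAlgebra Matrix
open Literature.MathematicalPhysics.QuantumLattice.FermiRG Literature.Probability.LatticeModels.BattleFederbush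
open Summit.HubbardSuperconductivity.HubbardSuperconductivity.Theorems.KLProgrammeLegKernels
open Summit.HubbardSuperconductivity.HubbardSuperconductivity.Theorems.TwoLegFourier
open Summit.HubbardSuperconductivity.HubbardSuperconductivity.Theorems.EngineV8
open Summit.HubbardSuperconductivity.HubbardSuperconductivity.Theorems.PerturbedFermiCurve
open Summit.HubbardSuperconductivity.HubbardSuperconductivity.Theorems.DispersionFlow
open Summit.HubbardSuperconductivity.HubbardSuperconductivity.Theorems.C4a (bell4)
open scoped Nat

section Assembly

variable {L M : ℕ} [NeZero L] [NeZero M] {μ U β : ℝ}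

set_option maxHeartbeats 400000 in -- three door-sized instantiations of written-out grid elements in one declaration
/-- **(C) AT `n = 0` FROM THE TAIL ROWS, THE CERTIFIED SUNSET SUMS, THE SUNSET'S ON-CURVE ROWS 3–4 AND THE CHAIN'S ALIASING TABLE.**  See the module
docstring for the dictionary; `ε = β/4M`, `A = contr (S_{4M}ᵀC⁰_{>e₀}S_{4M})`, `S` / `Q_c` / `D_e` / `T₃` written out as in `…SunsetSplit`. -/
theorem twoLegRead_frameZero_of_sunsetData (hβ : klBetaMin ≤ β) (hμ : μ ∈ klWindowC) {tv bSA : ℝ} {tb D bS sS a : ℕ → ℝ}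
    {Mdeg : ℕ} (hM : 8 ≤ Mdeg)
    (hTon : ∀ (σ : Fin 2) (p₀ : GridPoint L (2 * (2 * M))), ∑ p₁ : GridPoint L (2 * (2 * M)),
      (if p₁.2 - p₀.2 = 0 then (1 : ℝ) else 0) * ‖kernel ℂ (effAction ℂ ((hubbardGridSub L M β (2 * (2 * M))).transpose * hubbardCovAboveCT L M β μ 0 0 klE0 *
            hubbardGridSub L M β (2 * (2 * M))) (hubbardGridInteraction L (2 * (2 * M)) β U) -
          gaussConv ℂ ((hubbardGridSub L M β (2 * (2 * M))).transpose * hubbardCovAboveCT L M β μ 0 0 klE0 *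
            hubbardGridSub L M β (2 * (2 * M))) (hubbardGridInteraction L (2 * (2 * M)) β U) +
        (2 : ℂ)⁻¹ • (gaussConv ℂ ((hubbardGridSub L M β (2 * (2 * M))).transpose * hubbardCovAboveCT L M β μ 0 0 klE0 *
              hubbardGridSub L M β (2 * (2 * M))) (hubbardGridInteraction L (2 * (2 * M)) β U * hubbardGridInteraction L (2 * (2 * M)) β U) -
          gaussConv ℂ ((hubbardGridSub L M β (2 * (2 * M))).transpose * hubbardCovAboveCT L M β μ 0 0 klE0 *
              hubbardGridSub L M β (2 * (2 * M))) (hubbardGridInteraction L (2 * (2 * M)) β U) *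
            gaussConv ℂ ((hubbardGridSub L M β (2 * (2 * M))).transpose * hubbardCovAboveCT L M β μ 0 0 klE0 *
              hubbardGridSub L M β (2 * (2 * M))) (hubbardGridInteraction L (2 * (2 * M)) β U))) 2 (fun i => ((![p₀, p₁] i, σ), i))‖ ≤ tv * |U| * (β / ((2 * (2 * M) : ℕ) : ℝ)))
    (hToff : ∀ k ≤ 4, ∀ (σ : Fin 2) (p₀ : GridPoint L (2 * (2 * M))), ∑ p₁ : GridPoint L (2 * (2 * M)),
      (if p₁.2 - p₀.2 = 0 then (0 : ℝ) else
        (1 + (((p₁.2 - p₀.2) 0).valMinAbs.natAbs : ℝ) + (((p₁.2 - p₀.2) 1).valMinAbs.natAbs : ℝ)) ^ k) *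
        ‖kernel ℂ (effAction ℂ ((hubbardGridSub L M β (2 * (2 * M))).transpose * hubbardCovAboveCT L M β μ 0 0 klE0 *
            hubbardGridSub L M β (2 * (2 * M))) (hubbardGridInteraction L (2 * (2 * M)) β U) -
          gaussConv ℂ ((hubbardGridSub L M β (2 * (2 * M))).transpose * hubbardCovAboveCT L M β μ 0 0 klE0 *
            hubbardGridSub L M β (2 * (2 * M))) (hubbardGridInteraction L (2 * (2 * M)) β U) +
        (2 : ℂ)⁻¹ • (gaussConv ℂ ((hubbardGridSub L M β (2 * (2 * M))).transpose * hubbardCovAboveCT L M β μ 0 0 klE0 *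
              hubbardGridSub L M β (2 * (2 * M))) (hubbardGridInteraction L (2 * (2 * M)) β U * hubbardGridInteraction L (2 * (2 * M)) β U) -
          gaussConv ℂ ((hubbardGridSub L M β (2 * (2 * M))).transpose * hubbardCovAboveCT L M β μ 0 0 klE0 *
              hubbardGridSub L M β (2 * (2 * M))) (hubbardGridInteraction L (2 * (2 * M)) β U) *
            gaussConv ℂ ((hubbardGridSub L M β (2 * (2 * M))).transpose * hubbardCovAboveCT L M β μ 0 0 klE0 *
              hubbardGridSub L M β (2 * (2 * M))) (hubbardGridInteraction L (2 * (2 * M)) β U))) 2 (fun i => ((![p₀, p₁] i, σ), i))‖ ≤ tb k * U ^ 2 * (β / ((2 * (2 * M) : ℕ) : ℝ)))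
    (hSall : ∀ (σ : Fin 2) (p₀ : GridPoint L (2 * (2 * M))), ∑ p₁ : GridPoint L (2 * (2 * M)),
      (if p₁ = p₀ then (0 : ℝ) else (1 : ℝ) * ‖contr ℂ ((hubbardGridSub L M β (2 * (2 * M))).transpose * hubbardCovAboveCT L M β μ 0 0 klE0 *
                hubbardGridSub L M β (2 * (2 * M))) (((p₁, σ), 0) : GridLeg (GridPoint L (2 * (2 * M)))) ((p₀, σ), 1) *
              (contr ℂ ((hubbardGridSub L M β (2 * (2 * M))).transpose * hubbardCovAboveCT L M β μ 0 0 klE0 *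
                hubbardGridSub L M β (2 * (2 * M))) (((p₀, σ.rev), 0) : GridLeg (GridPoint L (2 * (2 * M)))) ((p₁, σ.rev), 1) *
                contr ℂ ((hubbardGridSub L M β (2 * (2 * M))).transpose * hubbardCovAboveCT L M β μ 0 0 klE0 *
                hubbardGridSub L M β (2 * (2 * M))) (((p₁, σ.rev), 0) : GridLeg (GridPoint L (2 * (2 * M)))) ((p₀, σ.rev), 1))‖) ≤ bSA * (((2 * (2 * M) : ℕ) : ℝ) / β))
    (hS0 : ∀ (σ : Fin 2) (p₀ : GridPoint L (2 * (2 * M))), ∑ p₁ : GridPoint L (2 * (2 * M)),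
      (if p₁ = p₀ then (0 : ℝ) else (if p₁.2 - p₀.2 = 0 then (0 : ℝ) else 1) * ‖contr ℂ ((hubbardGridSub L M β (2 * (2 * M))).transpose * hubbardCovAboveCT L M β μ 0 0 klE0 *
                hubbardGridSub L M β (2 * (2 * M))) (((p₁, σ), 0) : GridLeg (GridPoint L (2 * (2 * M)))) ((p₀, σ), 1) *
              (contr ℂ ((hubbardGridSub L M β (2 * (2 * M))).transpose * hubbardCovAboveCT L M β μ 0 0 klE0 *
                hubbardGridSub L M β (2 * (2 * M))) (((p₀, σ.rev), 0) : GridLeg (GridPoint L (2 * (2 * M)))) ((p₁, σ.rev), 1) *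
                contr ℂ ((hubbardGridSub L M β (2 * (2 * M))).transpose * hubbardCovAboveCT L M β μ 0 0 klE0 *
                hubbardGridSub L M β (2 * (2 * M))) (((p₁, σ.rev), 0) : GridLeg (GridPoint L (2 * (2 * M)))) ((p₀, σ.rev), 1))‖) ≤ bS 0 * (((2 * (2 * M) : ℕ) : ℝ) / β))
    (hSk : ∀ k, 1 ≤ k → k ≤ 2 → ∀ (σ : Fin 2) (p₀ : GridPoint L (2 * (2 * M))), ∑ p₁ : GridPoint L (2 * (2 * M)),
      (if p₁ = p₀ then (0 : ℝ) else
        Real.sqrt ((((p₁.2 - p₀.2) 0).valMinAbs.natAbs : ℝ) ^ 2 + (((p₁.2 - p₀.2) 1).valMinAbs.natAbs : ℝ) ^ 2) ^ k * ‖contr ℂ ((hubbardGridSub L M β (2 * (2 * M))).transpose * hubbardCovAboveCT L M β μ 0 0 klE0 *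
                hubbardGridSub L M β (2 * (2 * M))) (((p₁, σ), 0) : GridLeg (GridPoint L (2 * (2 * M)))) ((p₀, σ), 1) *
              (contr ℂ ((hubbardGridSub L M β (2 * (2 * M))).transpose * hubbardCovAboveCT L M β μ 0 0 klE0 *
                hubbardGridSub L M β (2 * (2 * M))) (((p₀, σ.rev), 0) : GridLeg (GridPoint L (2 * (2 * M)))) ((p₁, σ.rev), 1) *
                contr ℂ ((hubbardGridSub L M β (2 * (2 * M))).transpose * hubbardCovAboveCT L M β μ 0 0 klE0 *
                hubbardGridSub L M β (2 * (2 * M))) (((p₁, σ.rev), 0) : GridLeg (GridPoint L (2 * (2 * M)))) ((p₀, σ.rev), 1))‖) ≤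
        bS k * (((2 * (2 * M) : ℕ) : ℝ) / β))
    (hγ : ContDiff ℝ 4 fun θ : ℝ => (WithLp.toLp 2 (klFermiPoint μ 0 θ) : Momentum))
    (hD : ∀ θ : ℝ, ∀ i, 1 ≤ i → i ≤ 4 → ‖iteratedDeriv i (fun θ : ℝ => (WithLp.toLp 2 (klFermiPoint μ 0 θ) : Momentum)) θ‖ ≤ D i)
    (hSjet : ∀ k, 3 ≤ k → k ≤ 4 → ∀ θ : ℝ, |iteratedDeriv k (fun θ : ℝ => evalM (symInterp L (fun pp : TorusSite 2 L =>
        (∑ σσ : Fin 2, ((selfEnergy L M β (ExteriorAlgebra.map (Matrix.toLin' (gridSubMatrix L M β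
            (fun p : GridPoint L (2 * (2 * M)) => p.2) (fun p => gridTime β (2 * (2 * M)) p.1)))
          (∑ p' : GridPoint L (2 * (2 * M)), ∑ q' : GridPoint L (2 * (2 * M)), ∑ σ' : Fin 2,
          (if p' = q' then (0 : ℂ) else
            -((((U * (β / (2 * (2 * M) : ℕ)) : ℝ) : ℂ) ^ 2 *
              (contr ℂ ((hubbardGridSub L M β (2 * (2 * M))).transpose * hubbardCovAboveCT L M β μ 0 0 klE0 *
                  hubbardGridSub L M β (2 * (2 * M))) (((q', σ'), 0) : GridLeg (GridPoint L (2 * (2 * M)))) ((p', σ'), 1) *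
                (contr ℂ ((hubbardGridSub L M β (2 * (2 * M))).transpose * hubbardCovAboveCT L M β μ 0 0 klE0 *
                    hubbardGridSub L M β (2 * (2 * M))) (((p', σ'.rev), 0) : GridLeg (GridPoint L (2 * (2 * M)))) ((q', σ'.rev), 1) *
                  contr ℂ ((hubbardGridSub L M β (2 * (2 * M))).transpose * hubbardCovAboveCT L M β μ 0 0 klE0 *
                    hubbardGridSub L M β (2 * (2 * M))) (((q', σ'.rev), 0) : GridLeg (GridPoint L (2 * (2 * M)))) ((p', σ'.rev), 1)))))) •
            (gen ℂ (((p', σ'), 0) : GridLeg (GridPoint L (2 * (2 * M)))) * gen ℂ (((q', σ'), 1) : GridLeg (GridPoint L (2 * (2 * M))))))) (omega0 M, pp) σσ).re +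
        (selfEnergy L M β (ExteriorAlgebra.map (Matrix.toLin' (gridSubMatrix L M β
            (fun p : GridPoint L (2 * (2 * M)) => p.2) (fun p => gridTime β (2 * (2 * M)) p.1)))
          (∑ p' : GridPoint L (2 * (2 * M)), ∑ q' : GridPoint L (2 * (2 * M)), ∑ σ' : Fin 2,
          (if p' = q' then (0 : ℂ) else
            -((((U * (β / (2 * (2 * M) : ℕ)) : ℝ) : ℂ) ^ 2 *
              (contr ℂ ((hubbardGridSub L M β (2 * (2 * M))).transpose * hubbardCovAboveCT L M β μ 0 0 klE0 *
                  hubbardGridSub L M β (2 * (2 * M))) (((q', σ'), 0) : GridLeg (GridPoint L (2 * (2 * M)))) ((p', σ'), 1) *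
                (contr ℂ ((hubbardGridSub L M β (2 * (2 * M))).transpose * hubbardCovAboveCT L M β μ 0 0 klE0 *
                    hubbardGridSub L M β (2 * (2 * M))) (((p', σ'.rev), 0) : GridLeg (GridPoint L (2 * (2 * M)))) ((q', σ'.rev), 1) *
                  contr ℂ ((hubbardGridSub L M β (2 * (2 * M))).transpose * hubbardCovAboveCT L M β μ 0 0 klE0 *
                    hubbardGridSub L M β (2 * (2 * M))) (((q', σ'.rev), 0) : GridLeg (GridPoint L (2 * (2 * M)))) ((p', σ'.rev), 1)))))) •
            (gen ℂ (((p', σ'), 0) : GridLeg (GridPoint L (2 * (2 * M)))) * gen ℂ (((q', σ'), 1) : GridLeg (GridPoint L (2 * (2 * M))))))) ((omega0 M).rev, pp) σσ).re)) / 4))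
        (WithLp.toLp 2 (klFermiPoint μ 0 θ))) θ| ≤ sS k * U ^ 2)
    (hA : ∀ j ≤ 4, 2 * ((3 : ℝ) ^ j *
      (‖(-(((U * (β / (2 * (2 * M) : ℕ)) : ℝ) : ℂ) ^ 2 *
              ((-∑ k : FreqMomentum L M, ((1 / (β * (L : ℝ) ^ 2) : ℝ) : ℂ) ^ 2 * uvSymbolCT L M β μ 0 klE0 (k, 0)) *
               (-∑ k : FreqMomentum L M, ((1 / (β * (L : ℝ) ^ 2) : ℝ) : ℂ) ^ 2 * uvSymbolCT L M β μ 0 klE0 (k, 0)))) * ((((2 * (2 * M) : ℕ) : ℂ) ^ 2 / (β ^ 3 * (L : ℝ) ^ 2 : ℝ)) : ℂ))‖ *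
        (8 * (|β * (L : ℝ) ^ 2| * (2 / klE0)) * ((Mdeg ! : ℝ)) ^ 2 * (4 * 4 * (1 + 2 * (16 * (1 + 342) / klE0))) ^ Mdeg)) *
      (2 / ((2 * (L / 4 + 1) : ℕ) : ℝ)) ^ (Mdeg - j - 4) * (2 ^ 2 * ∑' k : Fin 2 → ℤ, ∏ i, (1 + (k i : ℝ) ^ 2)⁻¹)) ≤ a j * U ^ 2) :
    TwoLegReadJetBound L M
        (fun k => if k = 0 then 2 * tv + 4 else if k = 1 then 2 * tb 1 * D 1 + (bS 1 * D 1 + bell4 a D 1)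
          else if k = 2 then 2 * tb 2 * D 1 ^ 2 + 2 * tb 1 * D 2 + (bS 2 * D 1 ^ 2 + bS 1 * D 2 + bell4 a D 2)
          else if k = 3 then 2 * tb 3 * D 1 ^ 3 + 3 * (2 * tb 2) * D 1 * D 2 + 2 * tb 1 * D 3 + (sS 3 + bell4 a D 3)
          else if k = 4 then 2 * tb 4 * D 1 ^ 4 + 6 * (2 * tb 3) * D 1 ^ 2 * D 2 + 3 * (2 * tb 2) * D 2 ^ 2 + 4 * (2 * tb 2) * D 1 * D 3 + 2 * tb 1 * D 4 +
            (sS 4 + bell4 a D 4)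
          else 0)
        (fun k => if k = 0 then 2 * tb 0 + (bSA + a 0 + 2048 + 64 * (β / ((2 * (2 * M) : ℕ) : ℝ))) else 0) β U μ (klFlowFrameU L M β U μ 0) 0 ∧
      TwoLegReadOscAt L M (4 * tb 0 + 2 * (bS 0 + a 0)) β U μ (klFlowFrameU L M β U μ 0) 0 := by
  have hβ0 : 0 < β := lt_of_lt_of_le (by norm_num [klBetaMin]) hβ
  have hN : (0 : ℝ) < ((2 * (2 * M) : ℕ) : ℝ) := by have := NeZero.ne M; positivity
  -- the constant `c_e` and its size (π3b-ii)
  have hcE : |(∑ σ : Fin 2, ((((1 / (β * (L : ℝ) ^ 2) : ℝ) : ℂ)) * ∑ p : GridPoint L (2 * (2 * M)),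
      ((2 : ℂ) * ((2 : ℂ)⁻¹ * (((U * (β / (2 * (2 * M) : ℕ)) : ℝ) : ℂ) *
              (-∑ k : FreqMomentum L M, ((1 / (β * (L : ℝ) ^ 2) : ℝ) : ℂ) ^ 2 * uvSymbolCT L M β μ 0 klE0 (k, 0))) +
            (2 : ℂ)⁻¹ * (((U * (β / (2 * (2 * M) : ℕ)) : ℝ) : ℂ) ^ 2 *
              ((-∑ k : FreqMomentum L M, ((1 / (β * (L : ℝ) ^ 2) : ℝ) : ℂ) ^ 2 * uvSymbolCT L M β μ 0 klE0 (k, 0)) *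
                ∑ q : GridPoint L (2 * (2 * M)),
                  contr ℂ ((hubbardGridSub L M β (2 * (2 * M))).transpose * hubbardCovAboveCT L M β μ 0 0 klE0 *
                      hubbardGridSub L M β (2 * (2 * M))) (((p, σ.rev), 0) : GridLeg (GridPoint L (2 * (2 * M)))) ((q, σ.rev), 1) *
                    contr ℂ ((hubbardGridSub L M β (2 * (2 * M))).transpose * hubbardCovAboveCT L M β μ 0 0 klE0 *
                      hubbardGridSub L M β (2 * (2 * M))) (((q, σ.rev), 0) : GridLeg (GridPoint L (2 * (2 * M)))) ((p, σ.rev), 1))) -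
            (2 : ℂ)⁻¹ * ((((U * (β / (2 * (2 * M) : ℕ)) : ℝ) : ℂ) ^ 2 *
                ((-∑ k : FreqMomentum L M, ((1 / (β * (L : ℝ) ^ 2) : ℝ) : ℂ) ^ 2 * uvSymbolCT L M β μ 0 klE0 (k, 0)) *
                 (-∑ k : FreqMomentum L M, ((1 / (β * (L : ℝ) ^ 2) : ℝ) : ℂ) ^ 2 * uvSymbolCT L M β μ 0 klE0 (k, 0)))) *
              (-∑ k : FreqMomentum L M, ((1 / (β * (L : ℝ) ^ 2) : ℝ) : ℂ) ^ 2 * uvSymbolCT L M β μ 0 klE0 (k, 0)))))).re) / 2| ≤ 4 * |U| + 2048 * U ^ 2 + 64 * U ^ 2 * (β / ((2 * (2 * M) : ℕ) : ℝ)) := abs_diagConst_le (L := L) (M := M) hβ0 U μ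
  -- the chain's reading on the free curve is pure aliasing (p615543), in door form
  have hQ : ∀ θ : ℝ, |evalM (symInterp L (fun pp : TorusSite 2 L =>
        (∑ σσ : Fin 2, ((selfEnergy L M β (ExteriorAlgebra.map (Matrix.toLin' (gridSubMatrix L M β
            (fun p : GridPoint L (2 * (2 * M)) => p.2) (fun p => gridTime β (2 * (2 * M)) p.1))) (∑ p' : GridPoint L (2 * (2 * M)), ∑ q' : GridPoint L (2 * (2 * M)), ∑ σ' : Fin 2,
          ((((U * (β / (2 * (2 * M) : ℕ)) : ℝ) : ℂ) ^ 2 *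
              ((-∑ k : FreqMomentum L M, ((1 / (β * (L : ℝ) ^ 2) : ℝ) : ℂ) ^ 2 * uvSymbolCT L M β μ 0 klE0 (k, 0)) *
               (-∑ k : FreqMomentum L M, ((1 / (β * (L : ℝ) ^ 2) : ℝ) : ℂ) ^ 2 * uvSymbolCT L M β μ 0 klE0 (k, 0)))) *
            contr ℂ ((hubbardGridSub L M β (2 * (2 * M))).transpose * hubbardCovAboveCT L M β μ 0 0 klE0 *
              hubbardGridSub L M β (2 * (2 * M))) (((q', σ'), 0) : GridLeg (GridPoint L (2 * (2 * M)))) ((p', σ'), 1)) •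
            (gen ℂ (((p', σ'), 0) : GridLeg (GridPoint L (2 * (2 * M)))) * gen ℂ (((q', σ'), 1) : GridLeg (GridPoint L (2 * (2 * M))))))) (omega0 M, pp) σσ).re +
        (selfEnergy L M β (ExteriorAlgebra.map (Matrix.toLin' (gridSubMatrix L M β
            (fun p : GridPoint L (2 * (2 * M)) => p.2) (fun p => gridTime β (2 * (2 * M)) p.1))) (∑ p' : GridPoint L (2 * (2 * M)), ∑ q' : GridPoint L (2 * (2 * M)), ∑ σ' : Fin 2,
          ((((U * (β / (2 * (2 * M) : ℕ)) : ℝ) : ℂ) ^ 2 *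
              ((-∑ k : FreqMomentum L M, ((1 / (β * (L : ℝ) ^ 2) : ℝ) : ℂ) ^ 2 * uvSymbolCT L M β μ 0 klE0 (k, 0)) *
               (-∑ k : FreqMomentum L M, ((1 / (β * (L : ℝ) ^ 2) : ℝ) : ℂ) ^ 2 * uvSymbolCT L M β μ 0 klE0 (k, 0)))) *
            contr ℂ ((hubbardGridSub L M β (2 * (2 * M))).transpose * hubbardCovAboveCT L M β μ 0 0 klE0 *
              hubbardGridSub L M β (2 * (2 * M))) (((q', σ'), 0) : GridLeg (GridPoint L (2 * (2 * M)))) ((p', σ'), 1)) •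
            (gen ℂ (((p', σ'), 0) : GridLeg (GridPoint L (2 * (2 * M)))) * gen ℂ (((q', σ'), 1) : GridLeg (GridPoint L (2 * (2 * M))))))) ((omega0 M).rev, pp) σσ).re)) / 4)) (WithLp.toLp 2 (klFermiPoint μ 0 θ) : Momentum)| ≤ a 0 * U ^ 2 ∧
      ∀ k, 1 ≤ k → k ≤ 4 → |iteratedDeriv k (fun θ : ℝ => evalM (symInterp L (fun pp : TorusSite 2 L =>
        (∑ σσ : Fin 2, ((selfEnergy L M β (ExteriorAlgebra.map (Matrix.toLin' (gridSubMatrix L M β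
            (fun p : GridPoint L (2 * (2 * M)) => p.2) (fun p => gridTime β (2 * (2 * M)) p.1))) (∑ p' : GridPoint L (2 * (2 * M)), ∑ q' : GridPoint L (2 * (2 * M)), ∑ σ' : Fin 2,
          ((((U * (β / (2 * (2 * M) : ℕ)) : ℝ) : ℂ) ^ 2 *
              ((-∑ k : FreqMomentum L M, ((1 / (β * (L : ℝ) ^ 2) : ℝ) : ℂ) ^ 2 * uvSymbolCT L M β μ 0 klE0 (k, 0)) *
               (-∑ k : FreqMomentum L M, ((1 / (β * (L : ℝ) ^ 2) : ℝ) : ℂ) ^ 2 * uvSymbolCT L M β μ 0 klE0 (k, 0)))) *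
            contr ℂ ((hubbardGridSub L M β (2 * (2 * M))).transpose * hubbardCovAboveCT L M β μ 0 0 klE0 *
              hubbardGridSub L M β (2 * (2 * M))) (((q', σ'), 0) : GridLeg (GridPoint L (2 * (2 * M)))) ((p', σ'), 1)) •
            (gen ℂ (((p', σ'), 0) : GridLeg (GridPoint L (2 * (2 * M)))) * gen ℂ (((q', σ'), 1) : GridLeg (GridPoint L (2 * (2 * M))))))) (omega0 M, pp) σσ).re +
        (selfEnergy L M β (ExteriorAlgebra.map (Matrix.toLin' (gridSubMatrix L M β
            (fun p : GridPoint L (2 * (2 * M)) => p.2) (fun p => gridTime β (2 * (2 * M)) p.1))) (∑ p' : GridPoint L (2 * (2 * M)), ∑ q' : GridPoint L (2 * (2 * M)), ∑ σ' : Fin 2,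
          ((((U * (β / (2 * (2 * M) : ℕ)) : ℝ) : ℂ) ^ 2 *
              ((-∑ k : FreqMomentum L M, ((1 / (β * (L : ℝ) ^ 2) : ℝ) : ℂ) ^ 2 * uvSymbolCT L M β μ 0 klE0 (k, 0)) *
               (-∑ k : FreqMomentum L M, ((1 / (β * (L : ℝ) ^ 2) : ℝ) : ℂ) ^ 2 * uvSymbolCT L M β μ 0 klE0 (k, 0)))) *
            contr ℂ ((hubbardGridSub L M β (2 * (2 * M))).transpose * hubbardCovAboveCT L M β μ 0 0 klE0 *
              hubbardGridSub L M β (2 * (2 * M))) (((q', σ'), 0) : GridLeg (GridPoint L (2 * (2 * M)))) ((p', σ'), 1)) •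
            (gen ℂ (((p', σ'), 0) : GridLeg (GridPoint L (2 * (2 * M)))) * gen ℂ (((q', σ'), 1) : GridLeg (GridPoint L (2 * (2 * M))))))) ((omega0 M).rev, pp) σσ).re)) / 4)) (WithLp.toLp 2 (klFermiPoint μ 0 θ) : Momentum)) θ| ≤
        bell4 (fun j => a j * U ^ 2) D k := fun θ =>
    chain_readJets_frameZero_le_bell4 (L := L) (M := M) hβ0 hμ (((U * (β / (2 * (2 * M) : ℕ)) : ℝ) : ℂ) ^ 2 *
              ((-∑ k : FreqMomentum L M, ((1 / (β * (L : ℝ) ^ 2) : ℝ) : ℂ) ^ 2 * uvSymbolCT L M β μ 0 klE0 (k, 0)) *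
               (-∑ k : FreqMomentum L M, ((1 / (β * (L : ℝ) ^ 2) : ℝ) : ℂ) ^ 2 * uvSymbolCT L M β μ 0 klE0 (k, 0)))) hM hγ hD (A := fun j => a j * U ^ 2) hA θ
  -- the three momentum-side pieces together (1/4), the sunset's sizes from (3/4)
  obtain ⟨hV, hT, hJ⟩ := curveRows_of_threePieces (L := L) (M := M) (μ := μ) (β := β) _ _ _ hγ hD
    (scaleZeroDiag_symbol_const (L := L) (M := M) (μ := μ) (U := U) (β := β))
    (fun θ => (hQ θ).1) (fun k hk1 hk4 θ => (hQ θ).2 k hk1 hk4)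
    (sunset_value_le (L := L) (M := M) hβ0 hSall) (sunset_structuredValue_le (L := L) (M := M) hβ0 hS0)
    (sunset_supJet_le (L := L) (M := M) hβ0 hSk) hSjet
  have htab : ∀ k, 1 ≤ k → k ≤ 4 →
      (if k = 1 then bS 1 * U ^ 2 * D 1 + bell4 (fun j => a j * U ^ 2) D 1
        else if k = 2 then bS 2 * U ^ 2 * D 1 ^ 2 + bS 1 * U ^ 2 * D 2 + bell4 (fun j => a j * U ^ 2) D 2
        else if k = 3 then sS 3 * U ^ 2 + bell4 (fun j => a j * U ^ 2) D 3 else sS 4 * U ^ 2 + bell4 (fun j => a j * U ^ 2) D 4) =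
      (if k = 0 then bS 0 + a 0 else if k = 1 then bS 1 * D 1 + bell4 a D 1 else if k = 2 then bS 2 * D 1 ^ 2 + bS 1 * D 2 + bell4 a D 2
        else if k = 3 then sS 3 + bell4 a D 3 else sS 4 + bell4 a D 4) * U ^ 2 := by
    intro k hk1 hk4
    interval_cases k <;> simp [bell4_mul_sq] <;> ring
  have hkey : ∀ x : ℝ, x ≤ 4 * |U| + 2048 * U ^ 2 + 64 * U ^ 2 * (β / ((2 * (2 * M) : ℕ) : ℝ)) →
      bSA * U ^ 2 + a 0 * U ^ 2 + x ≤ 4 * |U| + (bSA + a 0 + 2048 + 64 * (β / ((2 * (2 * M) : ℕ) : ℝ))) * U ^ 2 := fun x hx => by nlinarith [hx]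
  -- the MIXED door (k3c3-p1 p608958); `W_a″`, `W_b″` are inferred from the rows (2/4) and the split closes by `abel`
  obtain ⟨hJB, hO⟩ := twoLegRead_frameZero_of_split_certD (L := L) (M := M) hβ (hv := 4) (h0 := bSA + a 0 + 2048 + 64 * (β / ((2 * (2 * M) : ℕ) : ℝ)))
    (s := (fun k : ℕ => if k = 0 then bS 0 + a 0 else if k = 1 then bS 1 * D 1 + bell4 a D 1 else if k = 2 then bS 2 * D 1 ^ 2 + bS 1 * D 2 + bell4 a D 2
        else if k = 3 then sS 3 + bell4 a D 3 else sS 4 + bell4 a D 4))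
    _ _ (by abel) (scaleZeroWa_onSite_row (L := L) (M := M) hTon) (scaleZeroWa_offSite_row (L := L) (M := M) hToff) hγ hD
    (fun θ => (hV θ).trans (hkey _ hcE)) (fun θ => (hT θ).trans (le_of_eq (by simp; ring)))
    (fun k hk1 hk4 θ => (hJ k hk1 hk4 θ).trans (le_of_eq (by rw [htab k hk1 hk4])))
  refine ⟨TwoLegReadJetBound.mono (fun k => le_of_eq ?_) (fun k => le_rfl) hJB, hO.mono (le_of_eq (by simp))⟩
  match k with
  | 0 => simp
  | 1 => simp
  | 2 => simp
  | 3 => simp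
  | 4 => simp
  | k + 5 => simp

end Assembly

end Summit.HubbardSuperconductivity.HubbardSuperconductivity.Theorems.KLRegimeSplit

end
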